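import Summits.CriticalPhenomena.PercolationContinuityZ3.Theorems.FK.ConvexLimitSlopes
import Literature.Probability.LatticeModels.GibbsEnergyBounds
import Mathlib.Analysis.Convex.Continuous
import HarnessLib

/-!
# THE ISING PRESSURE IS CONVEX IN `β`, AND ITS `β`-CHORDS AT ZERO FIELD ARE SANDWICHED BY THE NEAREST-NEIGHBOUR ENERGIES:
# `Σᵢ ⟨σ_0σ_{eᵢ}⟩⁺_{β'} ≤ (ψ(β,0) − ψ(β',0))/(β − β') ≤ Σᵢ ⟨σ_0σ_{eᵢ}⟩^∅_{β}` (`0 ≤ β' < β`)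
# (Friedli–Velenik 2017, Lemma 3.5 / Exercise 3.2, Thm. 3.6; Lebowitz 1977, §3, p. 470 "general arguments")

Claimed R42 (8)(c) in the cell INBOX at 2026-08-29T00:59:05Z by fkp-10a gen 357 (NEW CLAIM #1 of the gen), addressed to coordinator fk-4 (next seated gen; gen 284 CLOSED l.8632; (ι) in force for windows); lineage row FO-10a-g357 (self-suggested), package g357-energy, label EB-A.
Helper file of the `fk-continuity` build cell (bschramm lane; `--supports stmt-CriticalPhenomena-4575`); builds on
p205010 (kernel theorem, internal audit signed; external expert review pending). No definitions, no named facts, no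
sorries; standard axioms. UNCONDITIONAL (nearest-neighbour Ising model on `ℤ^d`, every `d`).

`ψ(β,h) = pressure d β h` is the box limit of `ψ^{bc}_Λ(β,h) = |Λ|⁻¹ log Z^{bc}_{Λ;β,h}`, independent of `bc` (tree
theorem `hasBoxLimit_pressureIn_holds`, Friedli–Velenik Thm. 3.6). The tree's Gibbs–Jensen chord inequality
`(β₂ − β₁) ⟨−H⟩_{Λ;β₁} ≤ log Z_Λ(β₂) − log Z_Λ(β₁)` (`mul_isingExpect_neg_hamiltonian_le_log_sub`, every real `β₁, β₂`)
says that `β ↦ log Z^{bc}_{Λ;β,h}` has a supporting line at every point, hence is convex; convexity passes to the limit.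
At zero field the chords of the limit are controlled by the infinite-volume nearest-neighbour energies
`Σᵢ ⟨σ_0σ_{eᵢ}⟩^{bc}_β` (`eᵢ = Pi.single i 1`, `i = 1,…,d`; `bc ∈ {∅, +}`):

* `convexOn_univ_of_forall_mul_le_sub` — a real function with a supporting line at every point is convex (pure analysis);
* `convexOn_log_isingPartitionFunction_beta`, `convexOn_pressureIn_beta` — **`β ↦ log Z^{bc}_{Λ;β,h}` and `β ↦ ψ^{bc}_Λ(β,h)`
  are convex on `ℝ`** (any finite graph, volume, field, boundary condition; Friedli–Velenik Lemma 3.5 / Exercise 3.2);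
* **`convexOn_pressure_beta`** — **`β ↦ ψ(β,h)` IS CONVEX ON `ℝ`** for every `h` (Friedli–Velenik Thm. 3.6), hence
  `continuous_pressure_beta`;
* `pressure_sub_pressure_le_mul_sum_freeCorr_nn` — the upper chord bound from the FREE boundary condition:
  `ψ(β,0) − ψ(β',0) ≤ (β − β') Σᵢ ⟨σ_0σ_{eᵢ}⟩^∅_β` for `0 ≤ β`, `β' < β` (the free finite-volume bond expectations are below
  their infinite-volume values, GKS II); the matching lower bound `(β − β') Σᵢ ⟨σ_0σ_{eᵢ}⟩⁺_{β'} ≤ ψ(β,0) − ψ(β',0)` is the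
  tree's `mul_sum_plusCorr_nn_le_pressure_sub_pressure` (`GibbsEnergyBounds`);
* **the slope sandwich** `sum_plusCorr_nn_le_slope_pressure_beta`, `slope_pressure_beta_le_sum_freeCorr_nn` and the
  one-state forms `sum_freeCorr_nn_le_slope_pressure_beta`, `slope_pressure_beta_le_sum_plusCorr_nn`
  (`⟨·⟩^∅ ≤ ⟨·⟩⁺`): for `0 ≤ β' < β`,
  `Σᵢ ⟨σ_0σ_{eᵢ}⟩^∅_{β'} ≤ Σᵢ ⟨σ_0σ_{eᵢ}⟩⁺_{β'} ≤ slope ψ(·,0) β' β ≤ Σᵢ ⟨σ_0σ_{eᵢ}⟩^∅_β ≤ Σᵢ ⟨σ_0σ_{eᵢ}⟩⁺_β`;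
* `monotoneOn_pressure_beta` — `β ↦ ψ(β,0)` is nondecreasing on `[0,∞)`; `slope_pressure_beta_le_card` — the chords are
  at most `d` (`0 ≤ ψ(β,0) − ψ(β',0) ≤ d (β − β')` on `[0,∞)`, `pressure_sub_pressure_mem_Icc`).

These are the inputs of the one-sided `β`-derivatives `∂^±ψ/∂β` (`PressureBetaDerivative`).

## References

* S. Friedli, Y. Velenik, *Statistical Mechanics of Lattice Systems*, CUP (2017), Lemma 3.5, Exercise 3.2, Thm. 3.6,
  Exercise 3.12. [FriedliVelenik2017]
* J. L. Lebowitz, *Coexistence of phases in Ising ferromagnets*, J. Stat. Phys. 16 (1977) 463–476, §3, proof of Thm. 2,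
  p. 470. [Lebowitz1977]
* R. T. Rockafellar, *Convex Analysis*, Princeton (1970), Thm. 10.8, Thm. 24.1. [Rockafellar1970]
-/

noncomputable section

namespace Summit.CriticalPhenomena.PercolationContinuityZ3.Theorems.FK

namespace IsingEnergyDensity

open MeasureTheory Filter Topology Finset Set
open Literature.Probability.LatticeModels
open Summit.CriticalPhenomena.PercolationContinuityZ3.Theorems.FK.ConcaveLimit

variable {d : ℕ}

/-! ### A function with a supporting line at every point is convex -/

/-- **Supporting lines give convexity**: if `(y − x) g(x) ≤ f(y) − f(x)` for all real `x, y` (the line of slope `g(x)`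
through `(x, f x)` supports the graph of `f`), then `f` is convex on `ℝ`. [cite: Rockafellar1970, Thm. 24.1 and Cor. 10.1.1] -/
theorem convexOn_univ_of_forall_mul_le_sub {f g : ℝ → ℝ} (h : ∀ x y, (y - x) * g x ≤ f y - f x) :
    ConvexOn ℝ univ f := by
  refine ⟨convex_univ, fun x _ y _ a b ha hb hab => ?_⟩
  obtain rfl : b = 1 - a := by linarith
  have h1 := mul_le_mul_of_nonneg_left (h (a • x + (1 - a) • y) x) ha
  have h2 := mul_le_mul_of_nonneg_left (h (a • x + (1 - a) • y) y) hb
  simp only [smul_eq_mul] at h1 h2 ⊢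
  nlinarith [h1, h2]

/-! ### Finite volume: `β ↦ log Z^{bc}_{Λ;β,h}` is convex -/

section FiniteVolume

variable {V : Type*} (G : SimpleGraph V) [DecidableEq V] [G.LocallyFinite]

/-- **`β ↦ log Z^{bc}_{Λ;β,h}` is convex on `ℝ`** (every finite graph, volume, field and boundary condition): the
Gibbs–Jensen chord inequality `(β₂ − β₁)⟨−H⟩_{Λ;β₁} ≤ log Z_Λ(β₂) − log Z_Λ(β₁)` is a supporting line at every `β₁`.
[cite: FriedliVelenik2017, Lemma 3.5 and Exercise 3.2] -/
theorem convexOn_log_isingPartitionFunction_beta (Λ : Finset V) (h : ℝ) (bc : BoundaryCondition V) :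
    ConvexOn ℝ univ (fun β => Real.log (isingPartitionFunction G Λ β h bc)) :=
  convexOn_univ_of_forall_mul_le_sub
    (g := fun β => isingExpect G Λ β h bc (fun σ => -isingHamiltonian G Λ h bc σ))
    fun x y => mul_isingExpect_neg_hamiltonian_le_log_sub G Λ x y h bc

/-- **The finite-volume pressure `β ↦ ψ^{bc}_Λ(β,h) = |Λ|⁻¹ log Z^{bc}_{Λ;β,h}` is convex on `ℝ`.**
[cite: FriedliVelenik2017, Lemma 3.5 and Exercise 3.2] -/
theorem convexOn_pressureIn_beta (Λ : Finset V) (h : ℝ) (bc : BoundaryCondition V) :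
    ConvexOn ℝ univ (fun β => pressureIn G Λ β h bc) := by
  have hc : (0 : ℝ) ≤ (#Λ : ℝ)⁻¹ := inv_nonneg.2 (Nat.cast_nonneg _)
  refine ((convexOn_log_isingPartitionFunction_beta G Λ h bc).smul hc).congr fun β _ => ?_
  simp only [pressureIn, smul_eq_mul, div_eq_inv_mul]

end FiniteVolume

/-! ### Infinite volume: `β ↦ ψ(β,h)` is convex and continuous -/

/-- **`β ↦ ψ(β,h)` IS CONVEX ON `ℝ`** for every field `h` (Friedli–Velenik Thm. 3.6: the pressure is a limit of the
convex finite-volume pressures). [cite: FriedliVelenik2017, Thm. 3.6 and Lemma 3.5] -/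
theorem convexOn_pressure_beta (h : ℝ) : ConvexOn ℝ univ (fun β => pressure d β h) :=
  convexOn_of_tendsto convex_univ (f := fun (L : ℕ) (β : ℝ) => pressureIn (zdGraph d) (box d L) β h .free)
    (fun L => convexOn_pressureIn_beta (zdGraph d) (box d L) h .free) fun β _ =>
      (hasBoxLimit_pressureIn_holds (d := d) β h .free :)

/-- **`β ↦ ψ(β,h)` is continuous on `ℝ`** (a convex function on an open interval). [cite: FriedliVelenik2017, Thm. 3.6] -/
theorem continuous_pressure_beta (h : ℝ) : Continuous fun β => pressure d β h := by
  have := (convexOn_pressure_beta (d := d) h).continuousOn_interior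
  rw [interior_univ] at this
  exact continuousOn_univ.1 this

/-! ### Zero field: the chords of `β ↦ ψ(β,0)` and the nearest-neighbour energies -/

/-- **Upper chord bound from the free boundary condition**: for `0 ≤ β` and `β' < β`,
`ψ(β,0) − ψ(β',0) ≤ (β − β') Σᵢ ⟨σ_0σ_{eᵢ}⟩^∅_β` (Gibbs–Jensen chord at `β` in the box `B(L)` with free boundary
condition, `⟨−H^∅_{B(L)}⟩^∅_{B(L);β} ≤ |B(L)| Σᵢ ⟨σ_0σ_{eᵢ}⟩^∅_β` by GKS II, and `ψ^∅_{B(L)} → ψ`).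
[cite: Lebowitz1977, §3, proof of Thm. 2, p. 470; FriedliVelenik2017, Exercise 3.12 and Thm. 3.6] -/
theorem pressure_sub_pressure_le_mul_sum_freeCorr_nn {β' β : ℝ} (hβ : 0 ≤ β) (hlt : β' < β) :
    pressure d β 0 - pressure d β' 0 ≤ (β - β') * ∑ i, freeCorr d β 0 {0, Pi.single i 1} := by
  have hδ : 0 < β - β' := sub_pos.2 hlt
  set F := ∑ i, freeCorr d β 0 {0, Pi.single i 1} with hF
  have hN : ∀ L : ℕ, (0 : ℝ) < #(box d L) := fun L => by
    exact_mod_cast Finset.card_pos.2 (box_nonempty d L)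
  have h2 : ∀ L : ℕ, pressureIn (zdGraph d) (box d L) β 0 .free - pressureIn (zdGraph d) (box d L) β' 0 .free ≤
      (β - β') * F := by
    intro L
    have hJ := mul_isingExpect_neg_hamiltonian_le_log_sub (zdGraph d) (box d L) β β' 0 .free
    have hE := isingExpect_neg_hamiltonian_free_box_le (d := d) hβ L
    rw [pressureIn, pressureIn, ← sub_div, div_le_iff₀ (hN L)]
    have hE' : (β - β') * isingExpect (zdGraph d) (box d L) β 0 .free
        (fun σ => -isingHamiltonian (zdGraph d) (box d L) 0 .free σ) ≤ (β - β') * (#(box d L) * F) :=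
      mul_le_mul_of_nonneg_left hE hδ.le
    nlinarith [hJ, hE']
  have hlim : Tendsto (fun L : ℕ => pressureIn (zdGraph d) (box d L) β 0 .free -
      pressureIn (zdGraph d) (box d L) β' 0 .free) atTop (𝓝 (pressure d β 0 - pressure d β' 0)) :=
    (hasBoxLimit_pressureIn_holds (d := d) β 0 .free).sub (hasBoxLimit_pressureIn_holds (d := d) β' 0 .free)
  exact le_of_tendsto' hlim h2

/-- **Lower slope bound**: for `0 ≤ β' < β`, `Σᵢ ⟨σ_0σ_{eᵢ}⟩⁺_{β'} ≤ slope ψ(·,0) β' β` (the plus boundary condition,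
tree theorem `mul_sum_plusCorr_nn_le_pressure_sub_pressure`). [cite: Lebowitz1977, §3, proof of Thm. 2, p. 470] -/
theorem sum_plusCorr_nn_le_slope_pressure_beta {β' β : ℝ} (hβ' : 0 ≤ β') (hlt : β' < β) :
    ∑ i, plusCorr d β' 0 {0, Pi.single i 1} ≤ slope (fun b => pressure d b 0) β' β := by
  rw [slope_def_field, le_div_iff₀ (sub_pos.2 hlt)]
  have := mul_sum_plusCorr_nn_le_pressure_sub_pressure (d := d) hβ' hlt
  linarith [mul_comm (β - β') (∑ i, plusCorr d β' 0 {0, Pi.single i 1})]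

/-- **Upper slope bound**: for `0 ≤ β`, `β' < β`, `slope ψ(·,0) β' β ≤ Σᵢ ⟨σ_0σ_{eᵢ}⟩^∅_β`.
[cite: Lebowitz1977, §3, proof of Thm. 2, p. 470] -/
theorem slope_pressure_beta_le_sum_freeCorr_nn {β' β : ℝ} (hβ : 0 ≤ β) (hlt : β' < β) :
    slope (fun b => pressure d b 0) β' β ≤ ∑ i, freeCorr d β 0 {0, Pi.single i 1} := by
  rw [slope_def_field, div_le_iff₀ (sub_pos.2 hlt)]
  have := pressure_sub_pressure_le_mul_sum_freeCorr_nn (d := d) hβ hlt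
  linarith [mul_comm (β - β') (∑ i, freeCorr d β 0 {0, Pi.single i 1})]

/-- One-state lower form: for `0 ≤ β' < β`, `Σᵢ ⟨σ_0σ_{eᵢ}⟩^∅_{β'} ≤ slope ψ(·,0) β' β` (`⟨·⟩^∅ ≤ ⟨·⟩⁺`, GKS).
[cite: Lebowitz1977, §3, proof of Thm. 2, p. 470] -/
theorem sum_freeCorr_nn_le_slope_pressure_beta {β' β : ℝ} (hβ' : 0 ≤ β') (hlt : β' < β) :
    ∑ i, freeCorr d β' 0 {0, Pi.single i 1} ≤ slope (fun b => pressure d b 0) β' β :=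
  (sum_le_sum fun _ _ => freeCorr_le_plusCorr hβ' le_rfl _).trans (sum_plusCorr_nn_le_slope_pressure_beta hβ' hlt)

/-- One-state upper form: for `0 ≤ β`, `β' < β`, `slope ψ(·,0) β' β ≤ Σᵢ ⟨σ_0σ_{eᵢ}⟩⁺_β` (`⟨·⟩^∅ ≤ ⟨·⟩⁺`, GKS).
[cite: Lebowitz1977, §3, proof of Thm. 2, p. 470] -/
theorem slope_pressure_beta_le_sum_plusCorr_nn {β' β : ℝ} (hβ : 0 ≤ β) (hlt : β' < β) :
    slope (fun b => pressure d b 0) β' β ≤ ∑ i, plusCorr d β 0 {0, Pi.single i 1} :=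
  (slope_pressure_beta_le_sum_freeCorr_nn hβ hlt).trans (sum_le_sum fun _ _ => freeCorr_le_plusCorr hβ le_rfl _)

/-- **The slope sandwich across two temperatures**: for `0 ≤ β' < β`,
`Σᵢ ⟨σ_0σ_{eᵢ}⟩⁺_{β'} ≤ slope ψ(·,0) β' β ≤ Σᵢ ⟨σ_0σ_{eᵢ}⟩^∅_β` — whence the tree's "forbidden gap" inequality
`Σᵢ ⟨σ_0σ_{eᵢ}⟩⁺_{β'} ≤ Σᵢ ⟨σ_0σ_{eᵢ}⟩^∅_β` (`sum_plusCorr_nn_le_sum_freeCorr_nn`). [cite: Lebowitz1977, §3, proof of Thm. 2, p. 470] -/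
theorem slope_pressure_beta_mem_Icc {β' β : ℝ} (hβ' : 0 ≤ β') (hlt : β' < β) :
    slope (fun b => pressure d b 0) β' β ∈
      Icc (∑ i, plusCorr d β' 0 {0, Pi.single i 1}) (∑ i, freeCorr d β 0 {0, Pi.single i 1}) :=
  ⟨sum_plusCorr_nn_le_slope_pressure_beta hβ' hlt, slope_pressure_beta_le_sum_freeCorr_nn (hβ'.trans hlt.le) hlt⟩

/-! ### Consequences: monotonicity and the Lipschitz bound of `β ↦ ψ(β,0)` on `[0,∞)` -/

/-- **`β ↦ ψ(β,0)` is nondecreasing on `[0,∞)`** (its chords there are `≥ Σᵢ ⟨σ_0σ_{eᵢ}⟩⁺_{β'} ≥ 0`, GKS I).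
[cite: FriedliVelenik2017, Exercise 3.12 and Thm. 3.6] -/
theorem monotoneOn_pressure_beta : MonotoneOn (fun b => pressure d b 0) (Ici 0) := by
  intro a ha b _ hab
  rcases hab.eq_or_lt with rfl | hlt
  · exact le_rfl
  have h1 := mul_sum_plusCorr_nn_le_pressure_sub_pressure (d := d) (mem_Ici.1 ha) hlt
  have h0 : 0 ≤ (b - a) * ∑ i, plusCorr d a 0 {0, Pi.single i 1} :=
    mul_nonneg (sub_pos.2 hlt).le (sum_nonneg fun i _ => plusCorr_nonneg (mem_Ici.1 ha) le_rfl _)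
  dsimp only
  linarith

/-- **The chords are at most `d`**: for `0 ≤ β`, `β' < β`, `slope ψ(·,0) β' β ≤ d` (`⟨σ_0σ_{eᵢ}⟩⁺_β ≤ 1`).
[cite: FriedliVelenik2017, Thm. 3.6 (proof)] -/
theorem slope_pressure_beta_le_card {β' β : ℝ} (hβ : 0 ≤ β) (hlt : β' < β) :
    slope (fun b => pressure d b 0) β' β ≤ d := by
  refine (slope_pressure_beta_le_sum_plusCorr_nn hβ hlt).trans ?_
  calc ∑ i, plusCorr d β 0 {0, Pi.single i 1} ≤ ∑ _i : Fin d, (1 : ℝ) :=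
        sum_le_sum fun i _ => plusCorr_le_one hβ le_rfl _
    _ = d := by simp

/-- **`0 ≤ ψ(β,0) − ψ(β',0) ≤ d (β − β')` for `0 ≤ β' ≤ β`** (monotone and `d`-Lipschitz on `[0,∞)`).
[cite: FriedliVelenik2017, Thm. 3.6 (proof)] -/
theorem pressure_sub_pressure_mem_Icc {β' β : ℝ} (hβ' : 0 ≤ β') (hle : β' ≤ β) :
    pressure d β 0 - pressure d β' 0 ∈ Icc 0 (d * (β - β')) := by
  rcases hle.eq_or_lt with rfl | hlt
  · simp
  refine ⟨sub_nonneg.2 (monotoneOn_pressure_beta (d := d) (mem_Ici.2 hβ') (mem_Ici.2 (hβ'.trans hle)) hle), ?_⟩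
  have := slope_pressure_beta_le_card (d := d) (hβ'.trans hle) hlt
  rw [slope_def_field, div_le_iff₀ (sub_pos.2 hlt)] at this
  exact this

end IsingEnergyDensity

end Summit.CriticalPhenomena.PercolationContinuityZ3.Theorems.FK

end
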